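import Mathlib
import Summits.ValiantsHypothesis.ValiantsHypothesis.Theorems.GrenetZeonHessianRankCodimTwoBorderDefs
import HarnessLib

/-!
# Crux `GrenetZeon.HessianRankCodimTwo` (stmt-ValiantsHypothesis-8061), line `good_plane`, ALL large `n`:
# the low-digit sum of the core block congruence in closed form

Seat val-width-8061-p1 g2 (memo `Cruxes/HessianRankCodimTwo/BorderedLatinAllN.md`, §2).  The core block
value `(I, J)` of the bordered Latin plane is, modulo `p`, `P_d^p · bordLow` (file `…BorderFrobenius`), where
`bordLow = Σ_{t ≤ r} C(p-2,t) C(r,t) a_d^{p-2-t} (u_I v_J)^t w^{r-t}` (`Theorems/…BorderDefs.lean`).  Here: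

* `cast_choose_prime_sub_one` — `C(p-1, k) = (-1)^k` in characteristic `p` (`k < p`);
* `cast_choose_prime_sub_two` — `C(p-2, t) = (-1)^t (t+1)` in characteristic `p` (`t + 2 ≤ p`);
* `sum_succ_mul_choose_mul_pow` — the binomial identity
  `Σ_{t ≤ r} (t+1) C(r,t) (-Z)^t Y^{r-t} = (Y - Z)^{r-1} (Y - (r+1) Z)` (`r ≥ 1`, any commutative ring);
* `bordLow_eq` — hence, in characteristic `p` and for `1 ≤ r ≤ p - 2`,
  `bordLow = a_d^{p-2-r} · (a_d w - u_I v_J)^{r-1} · (a_d w - (r+1) u_I v_J)`.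

So a core block value dies modulo `p` exactly when `P_d = 0`, `a_d = 0`, `a_d w = u_I v_J` or
`a_d w = (r+1) u_I v_J` — the input of the death count (`…BorderDeaths*`).  VP ≠ VNP is not moved.
-/

noncomputable section

open MvPolynomial Finset

-- single-conjunct layout `Summits/ValiantsHypothesis/ValiantsHypothesis`: duplicated namespace by design
set_option linter.dupNamespace false

namespace Summit.ValiantsHypothesis.ValiantsHypothesis.Theorems.GrenetZeonHessianRankCodimTwo

/-! ### Binomial coefficients `C(p-1, k)`, `C(p-2, t)` modulo `p` -/

section Choose

variable {A : Type*} [CommRing A] (p : ℕ) [hp : Fact p.Prime] [CharP A p]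

/-- `C(p-1, k) ≡ (-1)^k (mod p)` for `k < p`. [folklore] -/
theorem cast_choose_prime_sub_one {k : ℕ} (hk : k < p) :
    (((p - 1).choose k : ℕ) : A) = (-1) ^ k := by
  induction k with
  | zero => simp
  | succ k ih =>
    have hk' : k < p := by omega
    have hpas : (p - 1).choose k + (p - 1).choose (k + 1) = p.choose (k + 1) := by
      have := Nat.choose_succ_succ' (p - 1) k
      rw [show p - 1 + 1 = p from Nat.sub_add_cancel hp.out.one_lt.le] at this
      omega
    have hdvd : (p : A) ∣ ((p.choose (k + 1) : ℕ) : A) := by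
      obtain ⟨c, hc⟩ := hp.out.dvd_choose_self (Nat.succ_ne_zero k) hk
      exact ⟨c, by rw [hc]; push_cast; ring⟩
    have hzero : ((p.choose (k + 1) : ℕ) : A) = 0 := by
      obtain ⟨c, hc⟩ := hdvd
      rw [hc, CharP.cast_eq_zero A p, zero_mul]
    have h := congrArg (Nat.cast : ℕ → A) hpas
    rw [Nat.cast_add, ih hk', hzero] at h
    rw [pow_succ]
    linear_combination h

/-- `C(p-2, t) ≡ (-1)^t (t+1) (mod p)` for `t + 2 ≤ p`. [folklore] -/
theorem cast_choose_prime_sub_two {t : ℕ} (ht : t + 2 ≤ p) :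
    (((p - 2).choose t : ℕ) : A) = (-1) ^ t * (t + 1) := by
  induction t with
  | zero => simp
  | succ t ih =>
    have ht' : t + 2 ≤ p := by omega
    have hpas : (p - 2).choose t + (p - 2).choose (t + 1) = (p - 1).choose (t + 1) := by
      have := Nat.choose_succ_succ' (p - 2) t
      have h2 : p - 2 + 1 = p - 1 := by have := hp.out.two_le; omega
      rw [h2] at this
      omega
    have h := congrArg (Nat.cast : ℕ → A) hpas
    rw [Nat.cast_add, ih ht', cast_choose_prime_sub_one p (by omega)] at h
    push_cast
    rw [pow_succ]
    linear_combination h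

end Choose

/-! ### The binomial identity -/

section Binomial

variable {A : Type*} [CommRing A]

/-- `Σ_{t ≤ r} C(r,t) (-Z)^t Y^{r-t} = (Y - Z)^r`. [folklore] -/
theorem sum_choose_mul_neg_pow_mul_pow (Y Z : A) (r : ℕ) :
    ∑ t ∈ range (r + 1), (r.choose t : A) * (-Z) ^ t * Y ^ (r - t) = (Y - Z) ^ r := by
  rw [sub_eq_neg_add, add_pow]
  exact Finset.sum_congr rfl fun t _ => by ring

/-- `Σ_{t ≤ r} t C(r,t) (-Z)^t Y^{r-t} = - r Z (Y - Z)^{r-1}` (`r ≥ 1`). [folklore] -/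
theorem sum_mul_choose_mul_neg_pow_mul_pow (Y Z : A) (m : ℕ) :
    ∑ t ∈ range (m + 2), ((t : A) * ((m + 1).choose t : A)) * (-Z) ^ t * Y ^ (m + 1 - t) =
      -(((m + 1 : ℕ) : A) * Z * (Y - Z) ^ m) := by
  rw [Finset.sum_range_succ']
  simp only [Nat.cast_zero, zero_mul, add_zero]
  have hkey : ∀ t ∈ range (m + 1),
      (((t + 1 : ℕ) : A) * (((m + 1).choose (t + 1) : ℕ) : A)) * (-Z) ^ (t + 1) * Y ^ (m + 1 - (t + 1)) =
        -(((m + 1 : ℕ) : A) * Z) * (((m.choose t : ℕ) : A) * (-Z) ^ t * Y ^ (m - t)) := by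
    intro t _
    -- `(m+1) * C(m,t) = C(m+1,t+1) * (t+1)`
    have h : (m + 1) * m.choose t = (m + 1).choose (t + 1) * (t + 1) := Nat.add_one_mul_choose_eq m t
    have h' : (((m + 1 : ℕ) : A)) * ((m.choose t : ℕ) : A) =
        (((m + 1).choose (t + 1) : ℕ) : A) * ((t + 1 : ℕ) : A) := by
      have := congrArg (Nat.cast : ℕ → A) h
      simpa only [Nat.cast_mul] using this
    rw [show m + 1 - (t + 1) = m - t by omega, pow_succ]
    linear_combination ((-Z) ^ t * Y ^ (m - t) * (-Z)) * h'.symm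
  rw [Finset.sum_congr rfl hkey, ← Finset.mul_sum, sum_choose_mul_neg_pow_mul_pow]
  ring

/-- **`Σ_{t ≤ r} (t+1) C(r,t) (-Z)^t Y^{r-t} = (Y - Z)^{r-1} (Y - (r+1) Z)`** for `r = m + 1 ≥ 1`.
[folklore] -/
theorem sum_succ_mul_choose_mul_pow (Y Z : A) (m : ℕ) :
    ∑ t ∈ range (m + 2), (((t : A) + 1) * ((m + 1).choose t : A)) * (-Z) ^ t * Y ^ (m + 1 - t) =
      (Y - Z) ^ m * (Y - ((m + 2 : ℕ) : A) * Z) := by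
  have h1 := sum_choose_mul_neg_pow_mul_pow Y Z (m + 1)
  have h2 := sum_mul_choose_mul_neg_pow_mul_pow Y Z m
  have hsplit : ∑ t ∈ range (m + 2), (((t : A) + 1) * ((m + 1).choose t : A)) * (-Z) ^ t * Y ^ (m + 1 - t) =
      (∑ t ∈ range (m + 2), ((t : A) * ((m + 1).choose t : A)) * (-Z) ^ t * Y ^ (m + 1 - t)) +
        ∑ t ∈ range (m + 2), ((m + 1).choose t : A) * (-Z) ^ t * Y ^ (m + 1 - t) := by
    rw [← Finset.sum_add_distrib]
    exact Finset.sum_congr rfl fun t _ => by ring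
  rw [hsplit, h1, h2, pow_succ]
  push_cast
  ring

end Binomial

/-! ### The low-digit sum in closed form -/

section Low

variable (R : Type*) [CommRing R] (p : ℕ) [hp : Fact p.Prime] [CharP R p]

/-- **The low-digit sum modulo `p`.** For `1 ≤ r ≤ p - 2`, in characteristic `p`,
`bordLow = a_d^{p-2-r} · ((a_d w - u_I v_J)^{r-1} · (a_d w - (r+1) u_I v_J))`, `d = J - I`,
`u_I = bordEnt (some I) none`, `v_J = bordEnt none (some J)`, `w = bordEnt none none`. [folklore] -/
theorem bordLow_eq {r : ℕ} (hr1 : 1 ≤ r) (hrp : r + 2 ≤ p) (I J : Fin 3) :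
    bordLow R p r I J =
      X (J - I) ^ (p - 2 - r) *
        ((X (J - I) * bordEnt R none none - bordEnt R (some I) none * bordEnt R none (some J)) ^ (r - 1) *
          (X (J - I) * bordEnt R none none -
            ((r + 1 : ℕ) : MvPolynomial (Fin 3) R) * (bordEnt R (some I) none * bordEnt R none (some J)))) := by
  obtain ⟨m, rfl⟩ : ∃ m, r = m + 1 := ⟨r - 1, by omega⟩
  set Xd : MvPolynomial (Fin 3) R := X (J - I) with hXd
  set u : MvPolynomial (Fin 3) R := bordEnt R (some I) none
  set v : MvPolynomial (Fin 3) R := bordEnt R none (some J)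
  set w : MvPolynomial (Fin 3) R := bordEnt R none none
  have hbin := sum_succ_mul_choose_mul_pow (A := MvPolynomial (Fin 3) R) (Xd * w) (u * v) m
  rw [show m + 1 - 1 = m by omega, show m + 1 + 1 = m + 2 by omega, ← hbin, bordLow, Finset.mul_sum]
  refine Finset.sum_congr rfl fun t ht => ?_
  have htm : t ≤ m + 1 := by have := Finset.mem_range.mp ht; omega
  have hcast : ((((p - 2).choose t * (m + 1).choose t : ℕ)) : MvPolynomial (Fin 3) R) =
      (-1) ^ t * ((t : MvPolynomial (Fin 3) R) + 1) * ((m + 1).choose t : MvPolynomial (Fin 3) R) := by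
    push_cast
    rw [cast_choose_prime_sub_two p (by omega)]
  rw [hcast, show p - 2 - t = (p - 2 - (m + 1)) + (m + 1 - t) by omega, pow_add, mul_pow, mul_pow,
    neg_pow (u * v)]
  ring

end Low

end Summit.ValiantsHypothesis.ValiantsHypothesis.Theorems.GrenetZeonHessianRankCodimTwo
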